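import Summits.CriticalPhenomena.PercolationContinuityZ3.Theorems.PercNearOneGluingNoHeavyLowerTailThreePointProductFormFibreForestBridges
import HarnessLib

/-!
# The forest form of the halving lemma, II: THEOREM B — the unit identity
# (Sahi programme, prover prim-sahi-p2 gen 57)

Support file (`--supports stmt-CriticalPhenomena-4575`, helper); continues `…ProductFormFibreForestBridges` (same gen).  Standard axioms, no sorries,
no named facts, no definitions.  Memo `run/shared/lean/prim/prim-sahi/FROM-prim-sahi-p2-gen57-FOREST-FORM.md` §2.

With `b_k, x_k` := the numbers of bad / X₁ FOREST configurations with `k` open labels (a forest configuration = every open label is a bridge of its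
endpoints, spelled out inline), the forest form of the halving lemma (v) is (FOR) `Σ_k b_k ≤ Σ_k x_k` (memo: (FOR) on all finite multigraphs ⟹
`#bad ≤ #P1 + #P2` in every two-copy fibre ⟹ (v) on every weighted graph; 0 violations on every connected simple graph with ≤ 7 vertices and every
connected multigraph with ≤ 6 vertices, multiplicity ≤ 2, ≤ 12 labels).
* `card_open_update_true` [folklore] — opening a closed label raises the number of open labels by one.
* **`card_forest_sa_succ_eq_sum_units`** [this work] — THEOREM B (P1 half): for every `k`,
  `#{forests X : |X| = k+1, a ↔ s, a ↮ c} = Σ_{forests T : |T| = k, a,s,c pairwise separated} #{labels l : ends l = s(s, y), a ↔ y in T}`,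
  by the bijection 'delete / re-insert the first label of the tree path from `s` to `a`' (`exists_unit_label`, `unit_label_unique`,
  `not_reachable_of_unit_closed`, `forest_update_true/false` of part I).  Exchanging `s` and `c` gives the P2 half; summing over `k`,
  `#X₁-forests = Σ_{S0-forests T} (e_H(s,K_T) + e_H(c,K_T))`, so (FOR) reads `#bad forests ≤ Σ_{S0-forests} (e_H(s,K_T) + e_H(c,K_T))`.
[folklore] (bijective counting); [cite: Gladkov2024, Conjecture 10.1 (p. 18), arXiv:2408.08457] for the conjectures (P)/(v) served.
-/

namespace Summit.CriticalPhenomena.PercolationContinuityZ3.Theorems.ProductFormFibre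

open Finset Literature.Probability.Percolation
open Summit.CriticalPhenomena.PercolationContinuityZ3.Theorems (TransplantRecipes.mem_of_walk)

variable {V α : Type*}

section ForestUnitIdentity

variable (ends : α → Sym2 V)

/-! ### THEOREM B: the unit identity -/

section UnitIdentityB

variable [Fintype α] [DecidableEq α] [DecidableEq V] (a s c : V)

/-- Opening a closed label raises the number of open labels by one. [folklore] -/
theorem card_open_update_true (T : α → Bool) {l : α} (hl : T l = false) :
    (univ.filter fun b => Function.update T l true b = true).card = (univ.filter fun b => T b = true).card + 1 := by
  have hset : (univ.filter fun b => Function.update T l true b = true) = insert l (univ.filter fun b => T b = true) := by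
    ext b
    simp only [Finset.mem_filter, Finset.mem_univ, true_and, Finset.mem_insert]
    by_cases hb : b = l
    · subst hb; simp
    · simp [hb]
  rw [hset, Finset.card_insert_of_notMem]
  simp [hl]

open Classical in
/-- **THEOREM B (THE UNIT IDENTITY), `P1` half.**  For every `k`, the forests with `k + 1` open labels in which `a ↔ s` and `a ↮ c` are
equinumerous with the pairs (forest `T` with `k` open labels and `a, s, c` pairwise separated, label `l` of the multigraph joining the
VERTEX `s` to the open cluster of `a` in `T`) — delete / re-insert the first label of the tree path from `s` to `a`.  Hence (with the
`P2` half, `s ↔ c` exchanged) `x_{k+1} = Σ_{S0-forests T, |T| = k} (e_H(s, K_T) + e_H(c, K_T))`, and the forest form (FOR)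
`#bad forests ≤ #X₁ forests` is the charging statement `#bad forests ≤ Σ_T (e_H(s,K_T) + e_H(c,K_T))` (memo §2). [this work] -/
theorem card_forest_sa_succ_eq_sum_units (has : a ≠ s) (k : ℕ) :
    (univ.filter fun z : α → Bool =>
        (∀ l, z l = true → ∀ x y, ends l = s(x, y) →
          x ≠ y ∧ ¬ (openGraph (labelledOpen ends (Function.update z l false))).Reachable x y) ∧
        (univ.filter fun b => z b = true).card = k + 1 ∧
        (openGraph (labelledOpen ends z)).Reachable a s ∧ ¬ (openGraph (labelledOpen ends z)).Reachable a c).card =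
    ∑ T ∈ (univ.filter fun T : α → Bool =>
        (∀ l, T l = true → ∀ x y, ends l = s(x, y) →
          x ≠ y ∧ ¬ (openGraph (labelledOpen ends (Function.update T l false))).Reachable x y) ∧
        (univ.filter fun b => T b = true).card = k ∧
        ¬ (openGraph (labelledOpen ends T)).Reachable a s ∧ ¬ (openGraph (labelledOpen ends T)).Reachable a c ∧
        ¬ (openGraph (labelledOpen ends T)).Reachable s c),
      (univ.filter fun l : α => ∃ y, ends l = s(s, y) ∧ (openGraph (labelledOpen ends T)).Reachable a y).card := by
  -- the configuration with every label at `s` closed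
  let zs : (α → Bool) → α → Bool := fun z l => if s ∈ ends l then false else z l
  have hzs1 : ∀ z l, s ∈ ends l → zs z l = false := fun z l h => by simp [zs, h]
  have hzs2 : ∀ z l, s ∉ ends l → zs z l = z l := fun z l h => by simp [zs, h]
  -- abbreviations for the two sides
  set A := (univ.filter fun z : α → Bool =>
        (∀ l, z l = true → ∀ x y, ends l = s(x, y) →
          x ≠ y ∧ ¬ (openGraph (labelledOpen ends (Function.update z l false))).Reachable x y) ∧
        (univ.filter fun b => z b = true).card = k + 1 ∧
        (openGraph (labelledOpen ends z)).Reachable a s ∧ ¬ (openGraph (labelledOpen ends z)).Reachable a c) with hA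
  set B := (univ.filter fun T : α → Bool =>
        (∀ l, T l = true → ∀ x y, ends l = s(x, y) →
          x ≠ y ∧ ¬ (openGraph (labelledOpen ends (Function.update T l false))).Reachable x y) ∧
        (univ.filter fun b => T b = true).card = k ∧
        ¬ (openGraph (labelledOpen ends T)).Reachable a s ∧ ¬ (openGraph (labelledOpen ends T)).Reachable a c ∧
        ¬ (openGraph (labelledOpen ends T)).Reachable s c) with hB
  let U : (α → Bool) → Finset α := fun T => univ.filter fun l : α => ∃ y, ends l = s(s, y) ∧ (openGraph (labelledOpen ends T)).Reachable a y
  change A.card = ∑ T ∈ B, (U T).card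
  rw [← Finset.card_sigma]
  symm
  -- key facts about a pair `(T, l)` with `T ∈ B`, `l ∈ U T`
  have pair_facts : ∀ T : α → Bool, ∀ l : α, T ∈ B → l ∈ U T →
      ∃ y, ends l = s(s, y) ∧ (openGraph (labelledOpen ends T)).Reachable a y ∧ T l = false ∧
        ¬ (openGraph (labelledOpen ends T)).Reachable s y ∧ Function.update T l true ∈ A := by
    intro T l hT hl
    rw [hB, Finset.mem_filter] at hT
    obtain ⟨_, hfor, hcard, hnas, hnac, hnsc⟩ := hT
    simp only [U, Finset.mem_filter, Finset.mem_univ, true_and] at hl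
    obtain ⟨y, hly, hay⟩ := hl
    have hsy : ¬ (openGraph (labelledOpen ends T)).Reachable s y := fun h => hnas (hay.trans h.symm)
    have hys : y ≠ s := fun h => hnas (h ▸ hay)
    have hTl : T l = false := by
      by_contra hne
      have ht : T l = true := by cases h' : T l <;> simp_all
      exact hsy (SimpleGraph.Adj.reachable ((adj_labelled_iff ends T s y).2 ⟨⟨l, ht, hly⟩, hys.symm⟩))
    refine ⟨y, hly, hay, hTl, hsy, ?_⟩
    rw [hA, Finset.mem_filter]
    refine ⟨Finset.mem_univ _, forest_update_true ends T hfor hly hsy, ?_, ?_, ?_⟩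
    · rw [card_open_update_true T hTl, hcard]
    · have hay' : (openGraph (labelledOpen ends (Function.update T l true))).Reachable a y :=
        reachable_of_le ends (fun b hb => by
          by_cases hbl : b = l
          · subst hbl; simp
          · rw [Function.update_of_ne hbl]; exact hb) hay
      have hys' : (openGraph (labelledOpen ends (Function.update T l true))).Adj y s :=
        (adj_labelled_iff ends _ y s).2 ⟨⟨l, by simp, by rw [hly, Sym2.eq_swap]⟩, hys⟩
      exact hay'.trans hys'.reachable
    · intro hac
      have hupd : Function.update T l false = T := by
        funext b; by_cases hb : b = l
        · subst hb; simp [hTl]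
        · simp [Function.update_of_ne hb]
      have hsplit := reachable_update_true_split ends T hly hac
      rw [hupd] at hsplit
      rcases hsplit with h | ⟨h1, _⟩ | ⟨h1, h2⟩
      · exact hnac h
      · exact hnas h1
      · exact hnsc (h2)  -- `s ↔ c`?  here `h1 : a ↔ y`, `h2 : s ↔ c`
  refine Finset.card_bij (fun Tl _ => Function.update Tl.1 Tl.2 true) ?_ ?_ ?_
  · -- lands in `A`
    rintro ⟨T, l⟩ hTl
    rw [Finset.mem_sigma] at hTl
    obtain ⟨_, -, -, -, -, hmem⟩ := pair_facts T l hTl.1 hTl.2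
    exact hmem
  · -- injective
    rintro ⟨T₁, l₁⟩ h₁ ⟨T₂, l₂⟩ h₂ heq
    rw [Finset.mem_sigma] at h₁ h₂
    obtain ⟨y₁, e₁, r₁, hT₁l, -, hX₁⟩ := pair_facts T₁ l₁ h₁.1 h₁.2
    obtain ⟨y₂, e₂, r₂, hT₂l, -, -⟩ := pair_facts T₂ l₂ h₂.1 h₂.2
    simp only at heq
    have hB₁ := h₁.1; have hB₂ := h₂.1
    rw [hB, Finset.mem_filter] at hB₁ hB₂
    -- the forest `X`
    rw [hA, Finset.mem_filter] at hX₁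
    have hXfor := hX₁.2.1
    -- both `l₁` and `l₂` are unit labels of `X`
    have hzsX₁ : zs (Function.update T₁ l₁ true) = zs T₁ :=
      zs_eq_of_agree ends s zs hzs1 hzs2 (fun b hb => by
        have : b ≠ l₁ := by rintro rfl; rw [e₁] at hb; exact hb (Sym2.mem_mk_left _ _)
        rw [Function.update_of_ne this])
    have hzsX₂ : zs (Function.update T₂ l₂ true) = zs T₂ :=
      zs_eq_of_agree ends s zs hzs1 hzs2 (fun b hb => by
        have : b ≠ l₂ := by rintro rfl; rw [e₂] at hb; exact hb (Sym2.mem_mk_left _ _)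
        rw [Function.update_of_ne this])
    have hr₁ : (openGraph (labelledOpen ends (zs (Function.update T₁ l₁ true)))).Reachable a y₁ := by
      rw [hzsX₁]; exact reachable_zs_of_not_reachable ends a s zs hzs1 hzs2 has T₁ hB₁.2.2.2.1 r₁
    have hr₂ : (openGraph (labelledOpen ends (zs (Function.update T₁ l₁ true)))).Reachable a y₂ := by
      rw [heq, hzsX₂]; exact reachable_zs_of_not_reachable ends a s zs hzs1 hzs2 has T₂ hB₂.2.2.2.1 r₂
    have hl : l₁ = l₂ :=
      unit_label_unique ends a s zs hzs1 hzs2 (Function.update T₁ l₁ true) hXfor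
        (by simp) e₁ hr₁ (by rw [heq]; simp) e₂ hr₂
    subst hl
    have hT : T₁ = T₂ := by
      have h1 : Function.update (Function.update T₁ l₁ true) l₁ false = T₁ := by
        rw [Function.update_idem]; funext b; by_cases hb : b = l₁
        · subst hb; simp [hT₁l]
        · simp [Function.update_of_ne hb]
      have h2 : Function.update (Function.update T₂ l₁ true) l₁ false = T₂ := by
        rw [Function.update_idem]; funext b; by_cases hb : b = l₁
        · subst hb; simp [hT₂l]
        · simp [Function.update_of_ne hb]
      rw [← h1, ← h2, heq]
    subst hT
    rfl
  · -- surjective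
    intro X hX
    have hX' := hX
    rw [hA, Finset.mem_filter] at hX'
    obtain ⟨_, hXfor, hXcard, hXas, hXnac⟩ := hX'
    obtain ⟨l₀, y₀, hl₀, e₀, r₀⟩ := exists_unit_label ends a s zs hzs1 hzs2 has X hXas
    refine ⟨⟨Function.update X l₀ false, l₀⟩, ?_, ?_⟩
    · rw [Finset.mem_sigma]
      -- `zs X`-connections survive closing `l₀` (an `s`-label)
      have hmono : ∀ b, zs X b = true → Function.update X l₀ false b = true := by
        intro b hb
        by_cases hsb : s ∈ ends b
        · rw [hzs1 X b hsb] at hb; exact absurd hb Bool.false_ne_true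
        · have hbl : b ≠ l₀ := by rintro rfl; rw [e₀] at hsb; exact hsb (Sym2.mem_mk_left _ _)
          rw [Function.update_of_ne hbl, ← hzs2 X b hsb]; exact hb
      have hay : (openGraph (labelledOpen ends (Function.update X l₀ false))).Reachable a y₀ :=
        reachable_of_le ends hmono r₀
      refine ⟨?_, ?_⟩
      · rw [hB, Finset.mem_filter]
        refine ⟨Finset.mem_univ _, forest_update_false ends X hXfor l₀, ?_, ?_, ?_, ?_⟩
        · show (univ.filter fun b => Function.update X l₀ false b = true).card = k
          have hc := card_open_update_true (Function.update X l₀ false) (l := l₀) (by simp)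
          rw [Function.update_idem, Function.update_eq_self_iff.2 hl₀.symm, hXcard] at hc
          omega
        · exact not_reachable_of_unit_closed ends a s zs hzs1 hzs2 has X hXfor hl₀ e₀ r₀
        · exact fun h => hXnac (reachable_of_reachable_update_false ends X l₀ h)
        · intro h
          exact hXnac (hXas.trans (reachable_of_reachable_update_false ends X l₀ h))
      · simp only [U, Finset.mem_filter, Finset.mem_univ, true_and]
        exact ⟨y₀, e₀, hay⟩
    · simp only
      rw [Function.update_idem]
      exact Function.update_eq_self_iff.2 hl₀.symm

open Classical in
/-- **THEOREM B, both halves: `x_{k+1} = Σ_{S0-forests T, |T| = k} (e_H(s,K_T) + e_H(c,K_T))`.** [this work] -/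
theorem card_forest_X1_succ_eq_sum_units (has : a ≠ s) (hac : a ≠ c) (k : ℕ) :
    (univ.filter fun z : α → Bool =>
        (∀ l, z l = true → ∀ x y, ends l = s(x, y) →
          x ≠ y ∧ ¬ (openGraph (labelledOpen ends (Function.update z l false))).Reachable x y) ∧
        (univ.filter fun b => z b = true).card = k + 1 ∧
        (openGraph (labelledOpen ends z)).Reachable a s ∧ ¬ (openGraph (labelledOpen ends z)).Reachable a c).card +
    (univ.filter fun z : α → Bool =>
        (∀ l, z l = true → ∀ x y, ends l = s(x, y) →
          x ≠ y ∧ ¬ (openGraph (labelledOpen ends (Function.update z l false))).Reachable x y) ∧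
        (univ.filter fun b => z b = true).card = k + 1 ∧
        (openGraph (labelledOpen ends z)).Reachable a c ∧ ¬ (openGraph (labelledOpen ends z)).Reachable a s).card =
    ∑ T ∈ (univ.filter fun T : α → Bool =>
        (∀ l, T l = true → ∀ x y, ends l = s(x, y) →
          x ≠ y ∧ ¬ (openGraph (labelledOpen ends (Function.update T l false))).Reachable x y) ∧
        (univ.filter fun b => T b = true).card = k ∧
        ¬ (openGraph (labelledOpen ends T)).Reachable a s ∧ ¬ (openGraph (labelledOpen ends T)).Reachable a c ∧
        ¬ (openGraph (labelledOpen ends T)).Reachable s c),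
      ((univ.filter fun l : α => ∃ y, ends l = s(s, y) ∧ (openGraph (labelledOpen ends T)).Reachable a y).card +
       (univ.filter fun l : α => ∃ y, ends l = s(c, y) ∧ (openGraph (labelledOpen ends T)).Reachable a y).card) := by
  rw [Finset.sum_add_distrib, card_forest_sa_succ_eq_sum_units ends a s c has k, card_forest_sa_succ_eq_sum_units ends a c s hac k]
  congr 1
  refine Finset.sum_congr ?_ (fun _ _ => rfl)
  ext T
  simp only [Finset.mem_filter, Finset.mem_univ, true_and]
  constructor
  · rintro ⟨hf, hk, h1, h2, h3⟩
    exact ⟨hf, hk, h2, h1, fun h => h3 h.symm⟩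
  · rintro ⟨hf, hk, h1, h2, h3⟩
    exact ⟨hf, hk, h2, h1, fun h => h3 h.symm⟩

end UnitIdentityB

end ForestUnitIdentity

end Summit.CriticalPhenomena.PercolationContinuityZ3.Theorems.ProductFormFibre
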